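import Literature.AnabelianGeometry.SemiGraphs.StarSubSemiGraph
import Literature.AnabelianGeometry.SemiGraphs.AmbientVocabProp43iii

/-!
# The star-link of a covering: the iso-immersive / verticially iso-excisive / `𝔾`-closed clauses of its finite-open datum ([SemiAnbd] §4 pp.50–52, Prop 4.7 p.57)

Mochizuki, *Semi-graphs of anabelioids*, Publ. RIMS **42** (2006), §4 Def 4.1 (ii)–(iv) pp.50–51
(immersions, excisions; `(𝔾, Γ)`-structures, iso-immersive / iso-excisive; local structures), the objects
of `Loc(𝔾, Γ)` pp.51–52 (a finite open object carries "an iso-immersive, verticially iso-excisive local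
`(𝔾, Γ)`-structure" and "contains at least one non-isolated open edge which is, however, `𝔾`-closed"),
Rmk 4.1.1 p.51 (`𝔾`-closed edges), Rmk 4.2.1 p.52, and the proof of Prop 4.7 p.57 ("the link contained in
`𝔾₃` which is determined by the images `v₃`, `e₃`") (kurims `paper:url-f33ace170ff4`).
[cite: MochizukiSemiAnbd2006, Def 4.1, p. 50]

PROOF-ONLY brick B2 of the L3 lead's successor row «PROP47@REAL-CONSTRUCTION», item (γ) (cell abc-iut,
layer L3, seat abc-iut-L3-t12 gen 10; SHAPES memo `HOME/staging/L3/L3-t12/g10/SHAPES-gamma-LinkInCovering.md`;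
over brick B1 `StarSubSemiGraph.lean`).  For an object `X` of the ambient category with an arrow
`p : X ⟶ 𝔾` (the covering `𝔾₃ → 𝔾`) and a set `S` of vertices of `X`, the full star `X.starAt S` carries
the local `(𝔾, Γ)`-structure INDUCED by `X.starAt S ⟶ X ⟶ 𝔾` (abc-iut-L3-t3's `LocalGStructure.induced`),
at the real vocabulary `SemiAnbdVocab.ofReal R` (every residual `R`):

* `SemiGraph.IsImmersion.comp`, `SemiGraph.IsExcision.comp` — immersions / excisions of semi-graphs
  compose (§1 pp.13–14; not in the tree before);
* `isIsoImmersive_induced_starAt` — the induced local structure is ISO-IMMERSIVE when `X` is untangled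
  and `p` finite étale: at every component `c`, the structure morphism `(X.starAt S)[c] → X.starAt S → X → 𝔾`
  factors as the IMMERSION `(X.starAt S)[c] → X` (a localization arrow followed by the star inclusion,
  both locally trivial, over immersions of semi-graphs) followed by `p`;
* `isVerticiallyIsoExcisive_induced_starAt` — it is VERTICIALLY ISO-EXCISIVE: at a vertex `v ∈ S` the
  arrow `(X.starAt S)[v] → X` lies over `𝔾(X)[v] → 𝔾(X)` composed with the star inclusion, both EXCISIONS
  (the whole star of `v` is kept — the content of Rmk 4.2.1);
* `isGClosed_induced_starAt` — an edge of the star lying over a closed edge of `X` is `𝔾`-CLOSED (finite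
  étale arrows lie over proper morphisms of semi-graphs, abc-iut-L3-t7's `isProper_of_finiteEtale`);
* `exists_open_gClosed_edge_starAt` — the clause "contains at least one non-isolated open edge which is
  `𝔾`-closed": any closed edge of `X` with exactly one abutment in `S` becomes such an edge of the star.

What this does NOT supply (memo bricks B3, (δ)): quasi-coherence, total elevation and total universal
sub-coverticiality of the star-link (approximator heredity; fibre products of coverings), connectedness,
and hence the finite open OBJECT of `Loc(𝔾, Γ)` itself.  Nothing printed is discharged; typed ≠ proved;
nothing here takes a side on [IUTchIII] Cor. 3.12.
-/

noncomputable section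

namespace Literature.AnabelianGeometry.SemiGraphs

open CategoryTheory

universe v₁ u₁ u

/-! ### 1. Immersions and excisions of semi-graphs compose -/

namespace SemiGraph

variable {G₁ G₂ G₃ : SemiGraph.{u}} (φ : G₁ ⟶ G₂) (ψ : G₂ ⟶ G₃)

/-- The star map of a composite is the composite of the star maps.
[cite: MochizukiSemiAnbd2006, §1, p. 13] -/
theorem Hom.starMap_comp (v : G₁.Vertex) :
    Hom.starMap (φ ≫ ψ) v = Hom.starMap ψ (φ.vertexMap v) ∘ Hom.starMap φ v := by
  funext b
  exact Subtype.ext rfl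

/-- **Immersions compose.** [cite: MochizukiSemiAnbd2006, §1, p. 13] -/
theorem IsImmersion.comp {φ : G₁ ⟶ G₂} {ψ : G₂ ⟶ G₃} (hφ : IsImmersion φ) (hψ : IsImmersion ψ) :
    IsImmersion (φ ≫ ψ) := by
  intro v
  rw [Hom.starMap_comp]
  exact (hψ _).comp (hφ v)

/-- **Excisions compose.** [cite: MochizukiSemiAnbd2006, §1, p. 14] -/
theorem IsExcision.comp {φ : G₁ ⟶ G₂} {ψ : G₂ ⟶ G₃} (hφ : IsExcision φ) (hψ : IsExcision ψ) :
    IsExcision (φ ≫ ψ) := by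
  intro v
  rw [Hom.starMap_comp]
  exact (hψ _).comp (hφ v)

end SemiGraph

/-! ### 2. The induced local `(𝔾, Γ)`-structure on the star of a covering -/

namespace SgAQuot.SgA

open SemiGraphOfAnabelioids Loc

variable (R : BridgeResidual.{v₁, u₁, u}) (X : SgA.{v₁, u₁, u}) (S : Set X.toSgA.graph.Vertex)
  {G : SgA.{v₁, u₁, u}} (p : X ⟶ G) (Γ : Subgroup (Aut G))

/-- `X.starAt S ⟶ X ⟶ 𝔾` is locally finite étale when `p` is (the `𝔾`-structure of the star).
[cite: MochizukiSemiAnbd2006, Def 4.1 (iii), p. 50] -/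
theorem locallyFiniteEtale_starAtHom_comp (hp : locallyFiniteEtale p.hom.hom) :
    (SemiAnbdVocab.ofReal R).IsLocallyFiniteEtale (X.starAtHom S ≫ p) := by
  change locallyFiniteEtale (X.starAtHom S ≫ p).hom.hom
  rw [comp_hom_hom]
  exact comp_mem_locallyFiniteEtale (X.locallyFiniteEtale_starAtHom S) hp

/-- `(X.starAt S)[v] ⟶ X.starAt S ⟶ X` is an IMMERSION of the ambient category (Def 4.1 (ii): locally
trivial over an immersion of semi-graphs — `𝔾(X.starAt S)[v] → 𝔾(X.starAt S)` is an excision and the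
star inclusion an excision). [cite: MochizukiSemiAnbd2006, Def 4.1 (ii), p. 50] -/
theorem isImmersion_ιV_starAtHom (v : (X.starAt S).toSgA.graph.Vertex) :
    (SemiAnbdVocab.ofReal R).IsImmersion ((X.starAt S).ιV v ≫ X.starAtHom S) := by
  refine ⟨?_, (SemiAnbdVocab.ofReal_isGraphImmersion_iff R _).mpr ?_⟩
  · change locallyTrivial ((X.starAt S).ιV v ≫ X.starAtHom S).hom.hom
    rw [comp_hom_hom]
    exact comp_mem_locallyTrivial ((X.starAt S).locallyTrivial_ιV v) (X.locallyTrivial_starAtHom S)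
  · change SemiGraph.IsImmersion (((X.starAt S).ιV v).hom.hom ≫ (X.starAtHom S).hom.hom).base
    rw [SgAQuot.comp_base]
    exact ((X.starAt S).toSgA.graph.atVertexHom_isExcision v).isImmersion.comp
      (X.isImmersion_starAtHom_base S)

/-- `(X.starAt S)[v] ⟶ X` is even an EXCISION (Def 4.1 (ii)): the whole star of `v` is kept — the
"local surjectivity of branches" of Rmk 4.2.1. [cite: MochizukiSemiAnbd2006, Rmk 4.2.1, p. 52] -/
theorem isExcision_ιV_starAtHom (v : (X.starAt S).toSgA.graph.Vertex) :
    (SemiAnbdVocab.ofReal R).IsExcision ((X.starAt S).ιV v ≫ X.starAtHom S) := by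
  refine ⟨(X.isImmersion_ιV_starAtHom R S v).1, (SemiAnbdVocab.ofReal_isGraphExcision_iff R _).mpr ?_⟩
  change SemiGraph.IsExcision (((X.starAt S).ιV v).hom.hom ≫ (X.starAtHom S).hom.hom).base
  rw [SgAQuot.comp_base]
  exact ((X.starAt S).toSgA.graph.atVertexHom_isExcision v).comp (X.isExcision_starAtHom_base S)

/-- `(X.starAt S)[e] ⟶ X.starAt S ⟶ X` is an IMMERSION (over `𝔾(X.starAt S)[e] → 𝔾(X.starAt S)`, an
immersion, followed by the star inclusion). [cite: MochizukiSemiAnbd2006, Def 4.1 (ii), p. 50] -/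
theorem isImmersion_ιE_starAtHom (e : (X.starAt S).toSgA.graph.Edge) :
    (SemiAnbdVocab.ofReal R).IsImmersion ((X.starAt S).ιE e ≫ X.starAtHom S) := by
  refine ⟨?_, (SemiAnbdVocab.ofReal_isGraphImmersion_iff R _).mpr ?_⟩
  · change locallyTrivial ((X.starAt S).ιE e ≫ X.starAtHom S).hom.hom
    rw [comp_hom_hom]
    exact comp_mem_locallyTrivial ((X.starAt S).locallyTrivial_ιE e) (X.locallyTrivial_starAtHom S)
  · change SemiGraph.IsImmersion (((X.starAt S).ιE e).hom.hom ≫ (X.starAtHom S).hom.hom).base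
    rw [SgAQuot.comp_base]
    exact ((X.starAt S).toSgA.graph.atEdgeHom_isImmersion e).comp (X.isImmersion_starAtHom_base S)

/-- **The local `(𝔾, Γ)`-structure on the star induced by `X.starAt S ⟶ X ⟶ 𝔾` is ISO-IMMERSIVE**
(Def 4.1 (iii)/(iv)) when `X` is untangled and `p : X ⟶ 𝔾` finite étale: at every component `c` the
structure morphism `(X.starAt S)[c] → 𝔾` factors as the immersion `(X.starAt S)[c] → X` followed by `p`.
[cite: MochizukiSemiAnbd2006, Def 4.1 (iv), p. 51] -/
theorem isIsoImmersive_induced_starAt (hp : finiteEtale p.hom.hom) (hX : X.toSgA.graph.IsUntangled)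
    (hq : (SemiAnbdVocab.ofReal R).IsLocallyFiniteEtale (X.starAtHom S ≫ p)) :
    (LocalGStructure.induced (SemiAnbdVocab.ofReal R) (Γ := Γ) (X.starAtHom S ≫ p) hq).IsIsoImmersive := by
  have hunt : (SemiAnbdVocab.ofReal R).IsUntangled X := (SemiAnbdVocab.ofReal_isUntangled_iff R X).mpr hX
  refine ⟨fun v => ?_, fun e => ?_⟩
  · refine ⟨_, ⟨1, Γ.one_mem, (Category.comp_id _).symm⟩, X, (X.starAt S).ιV v ≫ X.starAtHom S, p,
      X.isImmersion_ιV_starAtHom R S v, hp, hunt, ?_⟩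
    exact Category.assoc _ _ _
  · refine ⟨_, ⟨1, Γ.one_mem, (Category.comp_id _).symm⟩, X, (X.starAt S).ιE e ≫ X.starAtHom S, p,
      X.isImmersion_ιE_starAtHom R S e, hp, hunt, ?_⟩
    exact Category.assoc _ _ _

/-- **The induced local `(𝔾, Γ)`-structure on the star is VERTICIALLY ISO-EXCISIVE** (Def 4.1 (iv)) when
`X` is untangled and `p` finite étale: at a vertex the structure morphism factors as the EXCISION
`(X.starAt S)[v] → X` followed by `p`. [cite: MochizukiSemiAnbd2006, Def 4.1 (iv), p. 51] -/
theorem isVerticiallyIsoExcisive_induced_starAt (hp : finiteEtale p.hom.hom)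
    (hX : X.toSgA.graph.IsUntangled)
    (hq : (SemiAnbdVocab.ofReal R).IsLocallyFiniteEtale (X.starAtHom S ≫ p)) :
    (LocalGStructure.induced (SemiAnbdVocab.ofReal R) (Γ := Γ) (X.starAtHom S ≫ p)
      hq).IsVerticiallyIsoExcisive := by
  have hunt : (SemiAnbdVocab.ofReal R).IsUntangled X := (SemiAnbdVocab.ofReal_isUntangled_iff R X).mpr hX
  intro v
  refine ⟨_, ⟨1, Γ.one_mem, (Category.comp_id _).symm⟩, X, (X.starAt S).ιV v ≫ X.starAtHom S, p,
    X.isExcision_ιV_starAtHom R S v, hp, hunt, ?_⟩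
  exact Category.assoc _ _ _

/-! ### 3. `𝔾`-closed edges of the star and the open `𝔾`-closed edge of a finite open object -/

/-- An edge of the star lies, along the induced structure, over its image under `X.starAt S ⟶ X ⟶ 𝔾`
(Rmk 4.1.1: the `Γ`-orbit of edges of `𝔾` determined by a structure morphism contains that image).
[cite: MochizukiSemiAnbd2006, Rmk 4.1.1, p. 51] -/
theorem edgeMap_mem_edgeOrbit_induced_starAt
    (hq : (SemiAnbdVocab.ofReal R).IsLocallyFiniteEtale (X.starAtHom S ≫ p))
    (e : (X.starAt S).toSgA.graph.Edge) :
    p.hom.hom.base.edgeMap e.1 ∈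
      (LocalGStructure.induced (SemiAnbdVocab.ofReal R) (Γ := Γ) (X.starAtHom S ≫ p) hq).edgeOrbit
        (SemiAnbdVocab.ofReal R) e := by
  refine ⟨(SemiAnbdVocab.ofReal R).ιE (X.starAt S) e ≫ (X.starAtHom S ≫ p),
    ⟨1, Γ.one_mem, (Category.comp_id _).symm⟩, ?_⟩
  -- `mapE (ιE ≫ starAtHom ≫ p) (centerE e) = p (ι e) = p e.1`
  rw [(SemiAnbdVocab.ofReal R).mapE_comp, (SemiAnbdVocab.ofReal R).mapE_centerE,
    (SemiAnbdVocab.ofReal R).mapE_comp]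
  rfl

/-- **An edge of the star lying over a CLOSED edge of `X` is `𝔾`-closed** for the induced structure
(Rmk 4.1.1), `p : X ⟶ 𝔾` being finite étale, hence lying over a PROPER morphism of semi-graphs
(abc-iut-L3-t7's `isProper_of_finiteEtale`: verticial cardinalities are preserved).
[cite: MochizukiSemiAnbd2006, Rmk 4.1.1, p. 51] -/
theorem isGClosed_induced_starAt (hp : finiteEtale p.hom.hom)
    (hq : (SemiAnbdVocab.ofReal R).IsLocallyFiniteEtale (X.starAtHom S ≫ p))
    (e : (X.starAt S).toSgA.graph.Edge) (he : X.toSgA.graph.IsClosedEdge e.1) :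
    (LocalGStructure.induced (SemiAnbdVocab.ofReal R) (Γ := Γ) (X.starAtHom S ≫ p) hq).IsGClosed
      (SemiAnbdVocab.ofReal R) e := by
  refine ⟨p.hom.hom.base.edgeMap e.1, X.edgeMap_mem_edgeOrbit_induced_starAt R S p Γ hq e, ?_⟩
  rw [SemiAnbdVocab.ofReal_isClosedEdge_iff]
  change G.toSgA.graph.vertCard (p.hom.hom.base.edgeMap e.1) = 2
  rw [isProper_of_finiteEtale hp e.1]
  exact he

/-- **The clause "contains at least one non-isolated open edge which is, however, `𝔾`-closed"** (p.52
l.1) for the star of a finite étale `p : X ⟶ 𝔾`: a CLOSED edge of `X` having one branch abutting INSIDE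
`S` and the other OUTSIDE `S` is, in `X.starAt S`, an edge of verticial cardinality `1` which is
`𝔾`-closed for the induced structure. [cite: MochizukiSemiAnbd2006, §4, p. 52] -/
theorem exists_open_gClosed_edge_starAt (hp : finiteEtale p.hom.hom)
    (hq : (SemiAnbdVocab.ofReal R).IsLocallyFiniteEtale (X.starAtHom S ≫ p))
    (e₀ : X.toSgA.graph.Edge) (he₀ : X.toSgA.graph.IsClosedEdge e₀)
    (b₁ b₂ : X.toSgA.graph.Branch) (hb₁ : X.toSgA.graph.edgeOf b₁ = e₀)
    (hb₂ : X.toSgA.graph.edgeOf b₂ = e₀) (v : X.toSgA.graph.Vertex) (hv : v ∈ S)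
    (hin : X.toSgA.graph.abuts b₁ = some v) (hout : ∀ w ∈ S, X.toSgA.graph.abuts b₂ ≠ some w) :
    ∃ e : (SemiAnbdVocab.ofReal R).Edge (X.starAt S),
      (SemiAnbdVocab.ofReal R).vertCard e = 1 ∧
        (LocalGStructure.induced (SemiAnbdVocab.ofReal R) (Γ := Γ) (X.starAtHom S ≫ p) hq).IsGClosed
          (SemiAnbdVocab.ofReal R) e := by
  let e : (X.starAt S).toSgA.graph.Edge :=
    ⟨e₀, hb₁ ▸ X.toSgA.graph.edgeOf_mem_starSubgraph_edges S hv hin⟩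
  refine ⟨e, ?_, X.isGClosed_induced_starAt R S p Γ hp hq e he₀⟩
  rw [SemiAnbdVocab.ofReal_vertCard_eq]
  -- `< 2` because `b₂` does not abut in the star, `≥ 1` because `b₁` does
  have hlt : (X.toSgA.graph.starSubgraph S).toSemiGraph.vertCard e < 2 :=
    X.toSgA.graph.isOpenEdge_starSubgraph_of S e b₂ hb₂ hout
  have hpos : 0 < (X.toSgA.graph.starSubgraph S).toSemiGraph.vertCard e := by
    change 0 < Nat.card ((X.toSgA.graph.starSubgraph S).toSemiGraph.verticialPortion e)
    have hmem : (⟨b₁, by rw [hb₁]; exact e.2⟩ : (X.toSgA.graph.starSubgraph S).toSemiGraph.Branch) ∈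
        (X.toSgA.graph.starSubgraph S).toSemiGraph.verticialPortion e :=
      (X.toSgA.graph.mem_verticialPortion_starSubgraph_iff S e _).mpr ⟨hb₁, v, hv, hin⟩
    -- the portion lies among the two branches of `e₀`: finite; it contains `b₁`: nonempty
    have hfin : ((X.toSgA.graph.starSubgraph S).toSemiGraph.verticialPortion e).Finite := by
      obtain ⟨c₁, c₂, -, h₁, h₂, hall⟩ := X.toSgA.graph.two_branches e₀
      refine (Set.toFinite ({⟨c₁, by rw [h₁]; exact e.2⟩, ⟨c₂, by rw [h₂]; exact e.2⟩} :
        Set (X.toSgA.graph.starSubgraph S).toSemiGraph.Branch)).subset ?_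
      intro x hx
      obtain ⟨hxe, -⟩ := (X.toSgA.graph.mem_verticialPortion_starSubgraph_iff S e x).mp hx
      simp only [Set.mem_insert_iff, Set.mem_singleton_iff]
      rcases hall x.1 hxe with hx1 | hx2
      · exact Or.inl (Subtype.ext hx1)
      · exact Or.inr (Subtype.ext hx2)
    haveI := hfin.to_subtype
    haveI : Nonempty ((X.toSgA.graph.starSubgraph S).toSemiGraph.verticialPortion e) := ⟨⟨_, hmem⟩⟩
    exact Nat.card_pos
  change (X.toSgA.graph.starSubgraph S).toSemiGraph.vertCard e = 1
  omega

end SgAQuot.SgA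

end Literature.AnabelianGeometry.SemiGraphs

end
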